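import Literature.AlgebraicGeometry.Resolution.MonomialCurveEmbeddingDimension
import Literature.AlgebraicGeometry.Resolution.Ridge

/-!
# [OURS · L1 W5.4 · kill test K5.4] Thick ridges do not contain the W-Q curves at the origin

Cell `res-hironaka`, LADDER-RESOLUTION rung L (rescue), kill test K5.4 of RESCUE-SEED slot W5.4
(«enclosure without LL-chains: Sing(Ě) ⊆ ridge of the tangent cone locally»), seat `res-L1-k54`,
pre-registration `HOME/L/res-L1-k54/PREREG-K5.4.md` (sha16 `2d4c7c42680933af`), CAS job `j258977`.
Host door: route `HilbertSamuelElimination`, informal crux `RidgeConfinement`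
(stmt-ResolutionOfSingularities-17845, Giraud's ridge). NOTHING here is a statement of H. Hironaka's
manuscript (2017); nothing here asserts that any statement of that manuscript holds or fails. The two
monomial curves are the prior cell's W-Q curves `γ₅ = (t⁹⁹, t¹⁸, t²⁰, t²⁴, t²⁹) ⊂ 𝔸⁵` and
`γ₄ = (s⁴¹, s⁹, s¹², s¹³) ⊂ 𝔸⁴` (tree `Literature.AlgebraicGeometry.Resolution.WQ5.w`, `WQ4.w`), which lie
in the top-multiplicity locus of the hypersurfaces `x² + G` (`p = 2`) resp. `x³ + G` (`p = 3`) of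
`…Hironaka2017.WQWitness` / `WQ3Witness` (job `j258977`, rows Q2: `γ ⊆ V(f, D_A f : |A| ≤ p − 1)`).

## What is proved (kernel part of the DEAD rows ★(W_G) of K5.4)

At the origin of either hypersurface the tangent cone is `V(x̄^p)`, an ADDITIVE form, so Giraud's ridge
(faîte) of the cone is the cone itself, `F₀ = V(x̄^p)` — recorded in the kernel as
`ridgeIdeal_span_X_pow` (`𝔉(⟨X_j^q⟩) = ⟨X_j^q⟩`, `q` a power of the exponential characteristic, from the
tree's `Resolution.ridgeIdeal_span_eq`). Reading ★(W_G) of the kill test transports this group scheme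
into `(Z, 0)`: a «thick hyperplane» `V(ℓ^q)` for a regular parameter `ℓ` (order one at `0`), and asks
whether it contains the singular locus near `0`. The answer is NO for every `ℓ` and every `q ≥ 1`, set-
and scheme-theoretically, because the curves have embedding dimension `n` at `0` (Herzog 1970; tree
`mem_idealOfVars_sq_of_monomialCurve_mul_eq_zero`):

* `mem_idealOfVars_sq_of_monomialCurve_pow_mul_eq_zero` — over a domain `R`, for an exponent vector `w`
  none of whose entries lies in the semigroup of the others: if `F^q · G` vanishes on `t ↦ (t^{w_i})`
  with `q ≠ 0` and `G(0) ≠ 0` (so `F^q · G` is a local equation of `V(F^q)` on the neighbourhood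
  `{G ≠ 0}` of `0`), then `F ∈ (x_1, …, x_n)²` — `F` is NOT a regular parameter at `0`.
* `WQ5.monomialCurve_pow_mul_ne_zero`, `WQ4.monomialCurve_pow_mul_ne_zero` — the instances: for
  `F ∉ 𝔪₀²` (a hypersurface germ smooth at `0`), `q ≠ 0`, `G(0) ≠ 0`, the function `F^q G` does NOT vanish
  on `γ₅` resp. `γ₄`; i.e. no thickening `V(ℓ^q)` of a smooth hypersurface germ through `0` — in
  particular not the ridge `V(x̄^p)` transported into `(Z,0)` by ANY regular system of parameters —
  contains `γ`, a fortiori not the top locus.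

So the «additive group scheme, non-smooth allowed» relaxation of RESCUE-SEED row W5.4 does not discharge
the containment obstruction `Literature.Barriers.ResolutionOfSingularities.NarasimhanMaximalContactNarrow`
(block (C)) at the W-Q origins: over a perfect residue field the reduced ridge is the directrix, a LINEAR
space, and containment is insensitive to the nilpotent thickening. (The tangent-level reading typed as
`Theorems.CampaignW54.SingInRidgeSchAt` holds at these points for the opposite, equally formal reason —
the cone is its own ridge; see the companion file `…CampaignW54SingInRidgeAdditiveCone`.)
References: J. Herzog, Manuscripta Math. 3 (1970) 175–193 (semigroup rings); J. Giraud, Ann. Sci. ÉNS 8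
(1975) §1.5–1.6 (faîte); V. Cossart, U. Jannsen, S. Saito, LNM 2270 (2020) Def. 2.26 (directrix).
-/

noncomputable section

-- single-problem summit: the doubled namespace component `ResolutionOfSingularities` is forced
set_option linter.dupNamespace false

open MvPolynomial

open Literature.AlgebraicGeometry.Resolution

namespace Summit.ResolutionOfSingularities.ResolutionOfSingularities.Theorems

namespace K54ThickRidge

universe u

variable {σ R : Type*} [CommRing R]

/-- **Thick hypersurfaces through a monomial curve of full embedding dimension are singular.** Over a domain
`R`, let `w` be an exponent vector with no `w_i` in the semigroup of the others (`hmin`). If `F^q · G`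
vanishes on the curve `t ↦ (t^{w_i})_i` with `q ≠ 0` and `G(0) ≠ 0`, then `F ∈ (x_i : i)²`: the local
equation `F^q` of the thickening `V(F^q)`, corrected by a unit `G` near `0`, cannot vanish on the curve
germ unless `F` is singular at `0`. [cite: Herzog1970, §1] -/
theorem mem_idealOfVars_sq_of_monomialCurve_pow_mul_eq_zero [IsDomain R] (w : σ → ℕ)
    (hw : ∀ i, w i ≠ 0) (hmin : ∀ i (α : σ →₀ ℕ), α i = 0 → Finsupp.weight w α ≠ w i)
    {F G : MvPolynomial σ R} {q : ℕ} (hq : q ≠ 0)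
    (hFG : monomialCurve w (F ^ q * G) = 0) (hG : constantCoeff G ≠ 0) :
    F ∈ idealOfVars σ R ^ 2 := by
  have h' : monomialCurve w (F * G) = 0 := by
    rw [map_mul, map_pow, mul_eq_zero] at hFG
    rw [map_mul, mul_eq_zero]
    exact hFG.imp (fun h => (pow_eq_zero_iff hq).mp h) id
  exact mem_idealOfVars_sq_of_monomialCurve_mul_eq_zero w hw hmin h' hG

/-- Contrapositive form: for `F ∉ 𝔪₀²` (a hypersurface smooth at the origin), `q ≠ 0` and `G(0) ≠ 0`, the
function `F^q · G` does not vanish on the curve. [cite: Herzog1970, §1] -/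
theorem monomialCurve_pow_mul_ne_zero [IsDomain R] (w : σ → ℕ)
    (hw : ∀ i, w i ≠ 0) (hmin : ∀ i (α : σ →₀ ℕ), α i = 0 → Finsupp.weight w α ≠ w i)
    {F G : MvPolynomial σ R} {q : ℕ} (hq : q ≠ 0)
    (hF : F ∉ idealOfVars σ R ^ 2) (hG : constantCoeff G ≠ 0) :
    monomialCurve w (F ^ q * G) ≠ 0 :=
  fun h => hF (mem_idealOfVars_sq_of_monomialCurve_pow_mul_eq_zero w hw hmin hq h hG)

/-! ## The ridge of the cone `V(X_j^q)` is the cone itself -/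

section Ridge

variable {K : Type u} [Field K] {n : ℕ}

/-- **The cone `V(X_j^q)`, `q = (exp. char K)^e`, is its own ridge**: `𝔉(⟨X_j^q⟩) = ⟨X_j^q⟩` (Giraud's
faîte of a cone cut out by an additive form; the tangent cone at the origin of `x^p + G`, `ord G > p`, is of
this shape with `j` the `x`-coordinate and `q = p`). [cite: Giraud1975, §1.5–1.6] -/
theorem ridgeIdeal_span_X_pow (j : Fin n) (e : ℕ) :
    ridgeIdeal (Ideal.span {(X j : MvPolynomial (Fin n) K) ^ ringExpChar K ^ e}) =
      Ideal.span {(X j : MvPolynomial (Fin n) K) ^ ringExpChar K ^ e} :=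
  ridgeIdeal_span_eq fun g hg => by
    rw [Set.mem_singleton_iff] at hg
    rw [hg]
    exact isAdditive_X_pow j e

/-- In characteristic `p` (prime): `𝔉(⟨X_j^p⟩) = ⟨X_j^p⟩` — the ridge of the double (`p = 2`) / triple
(`p = 3`) hyperplane `V(x̄^p)` is `V(x̄^p)` itself, a non-reduced additive subgroup scheme of `T_0 Z` whose
reduction is the hyperplane `V(x̄)` (the directrix). [cite: Giraud1975, §1.5–1.6] -/
theorem ridgeIdeal_span_X_pow_char (p : ℕ) [Fact p.Prime] [CharP K p] (j : Fin n) :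
    ridgeIdeal (Ideal.span {(X j : MvPolynomial (Fin n) K) ^ p}) =
      Ideal.span {(X j : MvPolynomial (Fin n) K) ^ p} := by
  have h := ridgeIdeal_span_X_pow (K := K) j 1
  rwa [pow_one, ringExpChar.eq K p] at h

end Ridge

/-! ## Instances: the two W-Q curves -/

/-- **K5.4, witness W5 (`𝔸⁵`, `p = 2`), reading ★(W_G): no thick hyperplane `V(F^q)` through the origin —
in particular not the ridge `V(x̄²)` of the tangent cone transported into `(Z, 0)` by any regular system of
parameters — contains the curve `γ₅ = (t⁹⁹, t¹⁸, t²⁰, t²⁴, t²⁹)`: for `F ∉ 𝔪₀²`, `q ≠ 0`, `G(0) ≠ 0`,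
`(F^q G)(γ₅(t)) ≠ 0` in `R[t]`, `R` any domain. [cite: Herzog1970, §1] -/
theorem WQ5.monomialCurve_pow_mul_ne_zero [IsDomain R] {F G : MvPolynomial (Fin 5) R} {q : ℕ}
    (hq : q ≠ 0) (hF : F ∉ idealOfVars (Fin 5) R ^ 2) (hG : constantCoeff G ≠ 0) :
    monomialCurve WQ5.w (F ^ q * G) ≠ 0 :=
  K54ThickRidge.monomialCurve_pow_mul_ne_zero WQ5.w WQ5.w_ne_zero WQ5.w_minimal hq hF hG

/-- **K5.4, witness W4 (`𝔸⁴`, `p = 3`), reading ★(W_G)**: the same for `γ₄ = (s⁴¹, s⁹, s¹², s¹³)`.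
[cite: Herzog1970, §1] -/
theorem WQ4.monomialCurve_pow_mul_ne_zero [IsDomain R] {F G : MvPolynomial (Fin 4) R} {q : ℕ}
    (hq : q ≠ 0) (hF : F ∉ idealOfVars (Fin 4) R ^ 2) (hG : constantCoeff G ≠ 0) :
    monomialCurve WQ4.w (F ^ q * G) ≠ 0 :=
  K54ThickRidge.monomialCurve_pow_mul_ne_zero WQ4.w WQ4.w_ne_zero WQ4.w_minimal hq hF hG

/-- Scheme-theoretic form at the W-Q origin of `𝔸⁵`: if the ideal of the thick hyperplane `(F^q)` lies in the
ideal of `γ₅` (`F^q` vanishes on the curve) with `q ≠ 0`, then `F ∈ 𝔪₀²`. [cite: Herzog1970, §1] -/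
theorem WQ5.mem_idealOfVars_sq_of_pow [IsDomain R] {F : MvPolynomial (Fin 5) R} {q : ℕ} (hq : q ≠ 0)
    (hF : monomialCurve WQ5.w (F ^ q) = 0) : F ∈ idealOfVars (Fin 5) R ^ 2 :=
  mem_idealOfVars_sq_of_monomialCurve_pow_mul_eq_zero WQ5.w WQ5.w_ne_zero WQ5.w_minimal hq
    (G := 1) (by rw [mul_one, hF]) (by rw [map_one]; exact one_ne_zero)

/-- Scheme-theoretic form at the W-Q origin of `𝔸⁴`. [cite: Herzog1970, §1] -/
theorem WQ4.mem_idealOfVars_sq_of_pow [IsDomain R] {F : MvPolynomial (Fin 4) R} {q : ℕ} (hq : q ≠ 0)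
    (hF : monomialCurve WQ4.w (F ^ q) = 0) : F ∈ idealOfVars (Fin 4) R ^ 2 :=
  mem_idealOfVars_sq_of_monomialCurve_pow_mul_eq_zero WQ4.w WQ4.w_ne_zero WQ4.w_minimal hq
    (G := 1) (by rw [mul_one, hF]) (by rw [map_one]; exact one_ne_zero)

end K54ThickRidge

end Summit.ResolutionOfSingularities.ResolutionOfSingularities.Theorems

end
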